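import Summits.QuantumAdvantage.QuantumAdvantage.Theorems.SosSandwichQueryRepairedLine
import Summits.QuantumAdvantage.QuantumAdvantage.Theorems.SosSandwichPseudoBoundedAALevelDescentOfPBAA
import Literature.Computability.QuantumComplexity.QueryPrograms
import HarnessLib

/-!
# The `Q_T` child line of `PseudoBoundedAA` (stmt-15237): the one-bit surrogate is a ONE-QUERY algorithm, so `AA_Q ⟹ LevelDescent_Q`

Companion of `Theorems/SosSandwichQueryRepairedLine.lean` (`aaQuery_of_homogeneousRungQ_of_levelDescentQ`:
`HomogeneousRung_Q → LevelDescent_Q → AA_Q`).  Here the converse calibration, exactly as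
`Cruxes.PseudoBoundedAA.Birth.levelDescent_of_pseudoBoundedAA` did for `K_T`:

* `oneBitAlg l` — an explicit ONE-query algorithm on one input bit with acceptance probability
  `l·x₀ + (1−l)/2` (`l ∈ [0,1]`): prepare `√l |0,0,1⟩ + √((1−l)/2)(|0,0,0⟩ + |0,1,0⟩)` by a Householder reflection
  (ancilla `1`: the target holds `0` and the query writes `x₀`; ancilla `0`: the target holds `|+⟩`, on which the
  XOR-query acts trivially), query, accept iff the target bit is `1` (`oneBitAlg_acceptProb`); so the one-bit
  surrogate `l·X₀ + (1−l)·½` of the `K_T` line lies in `Q_1`, not only in `K_1`;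
* `levelDescentQ_of_aaQuery` — **`AA_Q ⟹ LevelDescent_Q`** (surrogate `oneBitAlg l`, `l² = min(1, C(ε/T)^c)`,
  base class `T' = 1`, constants `(a, A, B) = (c, min(1,C)/4, 1)`).

Consequently the `Q_T` child line is an exact reduction MODULO the published degree-free rung on `Q_T`
(Escudero Gutiérrez 2023, Cor. 1.7): `AA_Q ⟺ LevelDescent_Q` given `HomogeneousRung_Q`
(`aaQuery_iff_levelDescentQ_of_homogeneousRungQ`).  Honest label: glue/calibration.

Sources: BealsEtAl2001 §2; AaronsonAmbainis2014 Conj. 6; EscuderoGutierrez2023 Cor. 1.7.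
-/

noncomputable section

set_option linter.dupNamespace false

namespace Summit.QuantumAdvantage.QuantumAdvantage.Theorems.SosSandwich

open Matrix Finset MvPolynomial Literature.Computability.Cryptography Literature.Computability.QuantumComplexity
open Literature.Computability.QuantumComplexity.QProg

namespace OneBitAlg

/-- The prepared amplitudes as a function of (target bit, ancilla): `√((1−l)/2)` on `(b, 0)`, `√l` on `(0, 1)`,
`0` on `(1, 1)`. [cite: BealsEtAl2001, §2] -/
def ampBA (l : ℝ) : Bool → Bool → ℝ
  | false, false => Real.sqrt ((1 - l) / 2)
  | true, false => Real.sqrt ((1 - l) / 2)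
  | false, true => Real.sqrt l
  | true, true => 0

/-- The prepared amplitudes on the basis `Fin 1 × Bool × Bool`. [cite: BealsEtAl2001, §2] -/
def amp (l : ℝ) (s : Fin 1 × Bool × Bool) : ℝ := ampBA l s.2.1 s.2.2

/-- The prepared vector is a unit vector for `l ∈ [0,1]`. [folklore] -/
theorem sum_amp_sq {l : ℝ} (h0 : 0 ≤ l) (h1 : l ≤ 1) : ∑ s : Fin 1 × Bool × Bool, amp l s ^ 2 = 1 := by
  rw [Fintype.sum_prod_type, Fintype.sum_unique, Fintype.sum_prod_type, Fintype.sum_bool, Fintype.sum_bool,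
    Fintype.sum_bool]
  simp only [amp, ampBA]
  rw [Real.sq_sqrt h0, Real.sq_sqrt (by linarith : (0:ℝ) ≤ (1 - l) / 2)]
  ring

/-- The start state. [cite: BealsEtAl2001, §2] -/
def startS : Fin 1 × Bool × Bool := (0, false, false)

end OneBitAlg

open OneBitAlg in
/-- **The one-bit one-query algorithm** with acceptance probability `l·x₀ + (1−l)/2` (`reducible` for rewriting).
[cite: BealsEtAl2001, §2] -/
@[reducible] def oneBitAlg (l : ℝ) : QQueryAlg 1 where
  W := Bool
  queries := 1
  unitaries := ![⟨householder (amp l) startS, householder_mem_unitaryGroup _ _⟩, 1]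
  start := startS
  accept := {s | s.2.1 = true}

open OneBitAlg in
/-- **Acceptance probability of the one-bit algorithm**: `l·x₀ + (1−l)/2`. [cite: BealsEtAl2001, §2] -/
theorem oneBitAlg_acceptProb {l : ℝ} (h0 : 0 ≤ l) (h1 : l ≤ 1) (x : Fin 1 → Bool) :
    (oneBitAlg l).acceptProb x = l * (if x 0 then 1 else 0) + (1 - l) / 2 := by
  classical
  have hfin : (oneBitAlg l).finalState x = queryOracle x *ᵥ fun s => (amp l s : ℂ) := by
    unfold QQueryAlg.finalState
    rw [Fin.foldl_succ, Fin.foldl_zero]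
    simp only [Fin.succ_zero_eq_one, Matrix.cons_val_zero, Matrix.cons_val_one]
    rw [householder_mulVec_single (sum_amp_sq h0 h1), OneMemClass.coe_one, Matrix.one_mulVec]
  have hr2 : Real.sqrt ((1 - l) / 2) ^ 2 = (1 - l) / 2 := Real.sq_sqrt (by linarith)
  have hl2 : Real.sqrt l ^ 2 = l := Real.sq_sqrt h0
  unfold QQueryAlg.acceptProb
  rw [Finset.sum_filter]
  simp only [hfin, queryOracle_mulVec_apply, Fintype.sum_prod_type, Fintype.sum_unique, Fintype.sum_bool,
    Set.mem_setOf_eq, if_true, Bool.false_eq_true, if_false, add_zero, amp, Complex.norm_real, Real.norm_eq_abs,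
    sq_abs]
  have e0 : (default : Fin 1) = 0 := Subsingleton.elim _ _
  rw [e0]
  cases hx : x 0
  · simp only [Bool.xor_false, ampBA, Bool.false_eq_true, if_false, mul_zero]
    rw [hr2]; ring
  · simp only [Bool.xor_true, Bool.not_true, ampBA, if_true, mul_one]
    rw [hl2, hr2]

/-- **`AA_Q` implies level descent inside `Q_T`** (`LevelDescent_Q` with `(a, A, B) = (c, min(1,C)/4, 1)`, base
class `T' = 1`): the one-bit surrogate of the `K_T` calibration is the acceptance probability of the ONE-query
algorithm `oneBitAlg l`, `l² = min(1, C(ε/T)^c)`. [cite: AaronsonAmbainis2014, Conj. 6] -/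
theorem levelDescentQ_of_aaQuery
    (h : ∃ (c : ℕ) (C : ℝ), 0 < C ∧ ∀ (N : ℕ) (Q : QQueryAlg N) (p : MvPolynomial (Fin N) ℝ) (ε : ℝ),
      1 ≤ Q.queries → (∀ x, evalBool p x = Q.acceptProb x) → 0 < ε → ε ≤ boolVariance p →
        ∃ i : Fin N, C * (ε / Q.queries) ^ c ≤ influence i p) :
    ∃ (a : ℕ) (A B : ℝ), 0 < A ∧ 0 < B ∧
      ∀ (N : ℕ) (Q : QQueryAlg N) (p : MvPolynomial (Fin N) ℝ) (ε : ℝ), 1 ≤ Q.queries →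
        (∀ x, evalBool p x = Q.acceptProb x) → 0 < ε → ε ≤ boolVariance p →
        ∃ (N' : ℕ) (Q' : QQueryAlg N') (q : MvPolynomial (Fin N') ℝ),
          1 ≤ Q'.queries ∧ Q'.queries ≤ Q.queries ∧ (∀ x, evalBool q x = Q'.acceptProb x) ∧
          (Q'.queries = 1 ∨ (∀ x : Fin N' → Bool,
            ∑ i : Fin N', (evalBool q x - evalBool q (Function.update x i (!x i))) =
              4 * (Q'.queries : ℝ) * (evalBool q x - boolAvg (evalBool q)))) ∧
          A * (ε / Q.queries) ^ a ≤ boolVariance q ∧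
          ∀ i : Fin N', ∃ i' : Fin N, influence i q ≤ B * influence i' p := by
  obtain ⟨c, C₀, hC₀, H⟩ := h
  refine ⟨c, min 1 C₀ / 4, 1, by positivity, one_pos, fun N Q p ε hT hp hε hv => ?_⟩
  obtain ⟨i', hi'⟩ := H N Q p ε hT hp hε hv
  set s : ℝ := (ε / Q.queries) ^ c with hs
  have hs0 : 0 ≤ s := by positivity
  set m : ℝ := min 1 (C₀ * s) with hm
  have hm0 : 0 ≤ m := le_min zero_le_one (by positivity)
  have hm1 : m ≤ 1 := min_le_left _ _
  set l : ℝ := Real.sqrt m with hl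
  have hl0 : 0 ≤ l := Real.sqrt_nonneg _
  have hl1 : l ≤ 1 := by rw [hl, ← Real.sqrt_one]; exact Real.sqrt_le_sqrt hm1
  have hl2 : l ^ 2 = m := Real.sq_sqrt hm0
  refine ⟨1, oneBitAlg l, C l * X 0 + C (1 - l) * C (1 / 2 : ℝ), le_rfl, hT, fun x => ?_, Or.inl rfl, ?_,
    fun i => ⟨i', ?_⟩⟩
  · rw [Cruxes.PseudoBoundedAA.Birth.evalBool_oneBitMix, oneBitAlg_acceptProb hl0 hl1]
  · rw [Cruxes.PseudoBoundedAA.Birth.boolVariance_oneBitMix, hl2]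
    have hkey : min 1 C₀ * s ≤ m := by
      rcases le_total (C₀ * s) 1 with hle | hge
      · rw [hm, min_eq_right hle]
        exact mul_le_mul_of_nonneg_right (min_le_right _ _) hs0
      · rw [hm, min_eq_left hge]
        have h1s : min 1 C₀ * s ≤ C₀ * s := mul_le_mul_of_nonneg_right (min_le_right _ _) hs0
        -- and `min 1 C₀ * s ≤ 1 * ... `: use `C₀ s ≥ 1` only through `m = 1 ≥ min(1,C₀) s`? No: bound by `1·s ≤ ?`
        -- Instead: `min 1 C₀ * s ≤ 1 * s`; but `s` may exceed 1. Use `min ≤ C₀` and `C₀ s ≥ 1 = m`? Wrong direction.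
        -- Correct route: `ε ≤ Var ≤ 1/4 < T`, hence `s ≤ 1` and `min 1 C₀ * s ≤ 1 * 1 = 1 = m`.
        have hv4 : boolVariance p ≤ 1 / 4 := by
          obtain ⟨p₀, hpb, -, hval⟩ := PBAAQuerySimulable.exists_pseudoBounded_acceptPoly Q
          have hpK : PseudoBounded Q.queries p := hpb.of_eval_eq fun y => by
            change evalBool p y = evalBool p₀ y
            rw [hp y, hval y]
          exact boolVariance_le_quarter hpK
        have hT1 : (1 : ℝ) ≤ Q.queries := by exact_mod_cast hT
        have hεT : ε / Q.queries ≤ 1 := by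
          rw [div_le_one (by positivity)]; linarith
        have hs1 : s ≤ 1 := pow_le_one₀ (by positivity) hεT
        calc min 1 C₀ * s ≤ 1 * 1 := mul_le_mul (min_le_left _ _) hs1 hs0 zero_le_one
          _ = 1 := one_mul 1
    have : min 1 C₀ / 4 * s = (min 1 C₀ * s) / 4 := by ring
    rw [this]
    linarith
  · rw [Cruxes.PseudoBoundedAA.Birth.influence_oneBitMix, hl2, one_mul]
    exact (min_le_right _ _).trans hi'

/-- **The `Q_T` child line is exact modulo the published rung**: granted a degree-free homogeneous rung on `Q_T`
(Escudero Gutiérrez 2023 Cor 1.7 shape, hypothesis `hH`), `AA_Q ⟺ LevelDescent_Q`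
(`aaQuery_of_homogeneousRungQ_of_levelDescentQ`, `levelDescentQ_of_aaQuery`). [cite: EscuderoGutierrez2023, Cor. 1.7]
[cite: AaronsonAmbainis2014, Conj. 6] -/
theorem aaQuery_iff_levelDescentQ_of_homogeneousRungQ
    (hH : ∃ C_H : ℝ, 0 < C_H ∧ ∀ (N : ℕ) (Q : QQueryAlg N) (p : MvPolynomial (Fin N) ℝ), 1 ≤ Q.queries →
      (∀ x, evalBool p x = Q.acceptProb x) →
      (∀ x : Fin N → Bool, ∑ i : Fin N, (evalBool p x - evalBool p (Function.update x i (!x i))) =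
        4 * (Q.queries : ℝ) * (evalBool p x - boolAvg (evalBool p))) →
      0 < boolVariance p → ∃ i : Fin N, C_H * boolVariance p ^ 2 ≤ influence i p) :
    (∃ (c : ℕ) (C : ℝ), 0 < C ∧ ∀ (N : ℕ) (Q : QQueryAlg N) (p : MvPolynomial (Fin N) ℝ) (ε : ℝ),
      1 ≤ Q.queries → (∀ x, evalBool p x = Q.acceptProb x) → 0 < ε → ε ≤ boolVariance p →
        ∃ i : Fin N, C * (ε / Q.queries) ^ c ≤ influence i p) ↔
    (∃ (a : ℕ) (A B : ℝ), 0 < A ∧ 0 < B ∧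
      ∀ (N : ℕ) (Q : QQueryAlg N) (p : MvPolynomial (Fin N) ℝ) (ε : ℝ), 1 ≤ Q.queries →
        (∀ x, evalBool p x = Q.acceptProb x) → 0 < ε → ε ≤ boolVariance p →
        ∃ (N' : ℕ) (Q' : QQueryAlg N') (q : MvPolynomial (Fin N') ℝ),
          1 ≤ Q'.queries ∧ Q'.queries ≤ Q.queries ∧ (∀ x, evalBool q x = Q'.acceptProb x) ∧
          (Q'.queries = 1 ∨ (∀ x : Fin N' → Bool,
            ∑ i : Fin N', (evalBool q x - evalBool q (Function.update x i (!x i))) =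
              4 * (Q'.queries : ℝ) * (evalBool q x - boolAvg (evalBool q)))) ∧
          A * (ε / Q.queries) ^ a ≤ boolVariance q ∧
          ∀ i : Fin N', ∃ i' : Fin N, influence i q ≤ B * influence i' p) :=
  ⟨levelDescentQ_of_aaQuery, aaQuery_of_homogeneousRungQ_of_levelDescentQ hH⟩

end Summit.QuantumAdvantage.QuantumAdvantage.Theorems.SosSandwich

end
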